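import Summits.QuantumFields.YangMills.Theses.UnitScaleTilt
import Literature.MathematicalPhysics.QuantumFieldTheory.Balaban1983to89.T3NontrivialityFromTiltRefine
import HarnessLib

/-!
# `UnitScaleTiltNontrivial` — WHAT THE ROUTE'S THREE LOAD-BEARING CRUXES BUY BEYOND THE LEAF: continuum SU(2) YM₃ on every torus
# WITH NON-TRIVIAL (NON-GAUSSIAN) PLAQUETTE LAWS (route `UnitScaleTilt`, rev 14; cell `ym3-torus`, seat `ym3-torus-p2` gen 15)

WHAT THIS IS NOT: not d = 4, not infinite volume, not a mass gap, not Clay; nothing of Bałaban's is asserted — the three cruxes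
`MinimiserStabilityRegPr` (stmt-QuantumFields-19200), `FluctuationComparisonRegPrIntL` (stmt-QuantumFields-20520) and `HistoryTailL`
(stmt-QuantumFields-19936) are HYPOTHESES here exactly as in the route's deciding theorem `Theses.UnitScaleTilt.closes`.

CONTENT.  The deciding theorem `closes (h200) (h201) (hK2) : YM3TorusSU2` extracts, for every family `F` and every `γ > 0`, a refinement
`F.refine n` whose coupling `γL^{-n}` lies below the three cruxes' thresholds and the K1 ∧ K2 datum `UnitTiltTail (F.refine n) ℰp (γL^{-n}) r w w'`
with summable rates (`T3InteriorExcision.unitTiltTail_of_interior`), then transfers EXISTENCE to `(F, γ)`.  §1 isolates that extraction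
(`exists_refine_unitTiltTail`, the deciding theorem's proof verbatim up to its last line).  §2 applies the cell's new transfer of
NON-TRIVIALITY (`T3NontrivialityFromTiltRefine.exists_uniformVariance_plaquette_of_refine_unitTiltTail`, p2 g15: no small-mass hypothesis —
a late-cut-off lower transfer, atomless plaquette laws, Chebyshev): **the same three hypotheses give, for EVERY torus family and EVERY
`γ > 0`, `ContinuumYM3Torus F ℰp γ` AND (NT3) `UniformVariance (F.scheme ℰp γ) (plaquette3 x μ ν) c` at every plaquette label**
(`ym3_nontrivial_of_cruxes`), hence `LimitPointsNontrivial`, and the weak limit loop law has a NON-GAUSSIAN plaquette marginal of variance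
`≥ c > 0` (`limitLoopLaw_nondegenerate_of_cruxes`).  So the ladder's (NG) binder of rung R3 adds NO estimate to the route: it is K1 ∧ K2 again.

References: C. King, CMP 102 (1986) 649–677 [King1986] (Thm 3.4 (3.9)–(3.13) pp.656–657, Props. 3.8–3.9 pp.664–665); T. Bałaban, CMP 102
(1985) 255–275 [Balaban1985UV3] ((1)–(3) p.256, (7) p.257); A. Jaffe, E. Witten [JaffeWittenClay2006] (§4 p.6, §6.5 p.11); S. Chatterjee
[Chatterjee2019YMProbabilists] (§6 p.19).
-/

noncomputable section

open MeasureTheory Filter Topology Set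
open Literature.MathematicalPhysics.QuantumFieldTheory.Balaban1983to89
open Literature.MathematicalPhysics.QuantumFieldTheory.Balaban1983to89.T3ContinuumYM3Torus
open Literature.MathematicalPhysics.QuantumFieldTheory.Balaban1983to89.T3UnitScaleTilt
open Literature.MathematicalPhysics.QuantumFieldTheory.Balaban1983to89.T3UnitLawDensityEML (ℰp measurableE_ℰp)
open Literature.MathematicalPhysics.QuantumFieldTheory.Balaban1983to89.T3NontrivialityFromTilt
open Literature.MathematicalPhysics.QuantumFieldTheory.Balaban1983to89.T3NontrivialityFromTiltRefine
open Summit.QuantumFields.YangMills.Theses.UnitScaleTilt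

namespace Summit.QuantumFields.YangMills.Theorems.UnitScaleTiltNontrivial

/-! ## §1 The refined tilt datum extracted by the deciding theorem -/

/-- **THE K1 ∧ K2 DATUM OF A REFINEMENT, FROM THE THREE CRUXES** (the body of `Theses.UnitScaleTilt.closes`, rev 14, up to its last line):
for every family `F` and every `γ > 0` there are `n` and summable `r, w, w'` with `UnitTiltTail (F.refine n) ℰp (γL^{-n}) r w w'`.
Order of choices as in the deciding theorem: `(c, b₁, p₁)` from the interior comparison crux at `L = F.L`; the tail's profile `(b₀′, p₀)`
above `(b₁, p₁)`; stability and comparison run at the DILATED profile `b₀′/c`; `ε₀`, `m`, the three `γ`-thresholds and `γ ≤ 1` met by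
refinement; then `T3InteriorExcision.unitTiltTail_of_interior`. [cite: King1986, Thm 3.4 (3.9)-(3.13) pp.656-657 and Props. 3.8-3.9 pp.664-665] -/
theorem exists_refine_unitTiltTail (h200 : MinimiserStabilityRegPr) (h201 : FluctuationComparisonRegPrIntL) (hK2 : HistoryTailL)
    (F : T3Family) {γ : ℝ} (hγ : 0 < γ) :
    ∃ (n : ℕ) (r w w' : ℕ → ℝ), Summable r ∧ Summable w ∧ Summable w' ∧
      UnitTiltTail (F.refine n) ℰp (γ * ((F.L : ℝ)⁻¹) ^ n) r w w' := by
  obtain ⟨c, b₁, p₁, hc0, hc1, hB⟩ := h201 F.L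
  obtain ⟨b₀', p₀, hb₁, hp₁, hb₀', hp₀, hT⟩ := hK2 F.L b₁ p₁
  have hb₀ : 0 < b₀' / c := div_pos hb₀' hc0
  have hb₁' : b₁ ≤ b₀' / c := by
    refine hb₁.trans ?_
    rw [le_div_iff₀ hc0]
    exact mul_le_of_le_one_right hb₀'.le hc1
  have hcb : c * (b₀' / c) = b₀' := by field_simp
  obtain ⟨ε₁, hε₁, hA⟩ := h200 F.L
  obtain ⟨ε₁', hε₁', hB'⟩ := hB (b₀' / c) p₀ hb₁' hp₁ hb₀ hp₀
  obtain ⟨m₁, hm₁⟩ := hA (min ε₁ ε₁') (lt_min hε₁ hε₁') (min_le_left _ _)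
  obtain ⟨m₂, hm₂⟩ := hB' (min ε₁ ε₁') (lt_min hε₁ hε₁') (min_le_right _ _)
  obtain ⟨γ₂, hγ₂, hT'⟩ := hT (max (max m₁ m₂) 1) (lt_of_lt_of_le Nat.one_pos (le_max_right _ _))
  obtain ⟨γ₃, hγ₃, hA'⟩ := hm₁ (max (max m₁ m₂) 1) ((le_max_left _ _).trans (le_max_left _ _)) (b₀' / c) p₀ hb₀ hp₀
  obtain ⟨γ₄, hγ₄, hB''⟩ := hm₂ (max (max m₁ m₂) 1) ((le_max_right _ _).trans (le_max_left _ _))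
  have hL : (1 : ℝ) < F.L := by exact_mod_cast F.hL.2
  have hL0 : (0 : ℝ) < F.L := zero_lt_one.trans hL
  have hγs : 0 < min (min γ₂ (min γ₃ γ₄)) 1 := lt_min (lt_min hγ₂ (lt_min hγ₃ hγ₄)) one_pos
  obtain ⟨n, hn⟩ := ((tendsto_pow_atTop_nhds_zero_of_lt_one (inv_nonneg.mpr hL0.le)
    (inv_lt_one_of_one_lt₀ hL)).eventually (ge_mem_nhds (div_pos hγs hγ))).exists
  have hpos : 0 < γ * ((F.L : ℝ)⁻¹) ^ n := mul_pos hγ (pow_pos (inv_pos.mpr hL0) n)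
  have hle : γ * ((F.L : ℝ)⁻¹) ^ n ≤ min (min γ₂ (min γ₃ γ₄)) 1 := by
    have e := mul_le_mul_of_nonneg_left hn hγ.le
    rwa [mul_div_cancel₀ _ hγ.ne'] at e
  have hle₂ : γ * ((F.L : ℝ)⁻¹) ^ n ≤ γ₂ := hle.trans ((min_le_left _ _).trans (min_le_left _ _))
  have hle₃ : γ * ((F.L : ℝ)⁻¹) ^ n ≤ γ₃ :=
    hle.trans ((min_le_left _ _).trans ((min_le_right _ _).trans (min_le_left _ _)))
  have hle₄ : γ * ((F.L : ℝ)⁻¹) ^ n ≤ γ₄ :=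
    hle.trans ((min_le_left _ _).trans ((min_le_right _ _).trans (min_le_right _ _)))
  have hle1 : γ * ((F.L : ℝ)⁻¹) ^ n ≤ 1 := hle.trans (min_le_right _ _)
  have hTn : HistoryTailAt (F.refine n) (γ * ((F.L : ℝ)⁻¹) ^ n) (c * (b₀' / c)) p₀ (max (max m₁ m₂) 1) := by
    rw [hcb]
    exact hT' (F.refine n) _ rfl hpos hle₂
  obtain ⟨r, w, w', hr, hw, hw', h⟩ :=
    T3InteriorExcision.unitTiltTail_of_interior hpos hle1 hb₀ hc1 (hA' (F.refine n) _ rfl hpos hle₃)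
      (hB'' (F.refine n) _ rfl hpos hle₄) hTn
  exact ⟨n, r, w, w', hr, hw, hw', h⟩

/-! ## §2 The leaf AND non-triviality, from the same three hypotheses -/

/-- **THE THREE CRUXES GIVE CONTINUUM SU(2) YM₃ ON EVERY TORUS WITH NON-TRIVIAL PLAQUETTE LAWS**: for every torus family `F`, EVERY
`γ > 0`, every base point and every pair of distinct directions, `ContinuumYM3Torus F ℰp γ` (the leaf's conjunct, as in `closes`) AND
`UniformVariance (F.scheme ℰp γ) (plaquette3 x μ ν) c` for some `c > 0` (NT3) — the non-triviality / non-Gaussianity binder of the rung is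
K1 ∧ K2 again, no further estimate. [cite: JaffeWittenClay2006, §4 p.6 and §6.5 p.11] -/
theorem ym3_nontrivial_of_cruxes (h200 : MinimiserStabilityRegPr) (h201 : FluctuationComparisonRegPrIntL) (hK2 : HistoryTailL)
    (F : T3Family) {γ : ℝ} (hγ : 0 < γ) (x : F.USite) {μ ν : Fin 3} (hμν : μ ≠ ν) :
    ContinuumYM3Torus F ℰp γ ∧ ∃ c : ℝ, UniformVariance (F.scheme ℰp γ) (plaquette3 x μ ν) c := by
  obtain ⟨n, r, w, w', hr, hw, hw', h⟩ := exists_refine_unitTiltTail h200 h201 hK2 F hγ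
  exact ⟨continuumYM3Torus_of_refine_unitTiltTail F ℰp measurableE_ℰp n hγ.le hr hw hw' h,
    exists_uniformVariance_plaquette_of_refine_unitTiltTail F n hγ.le h hr hw hw' x hμν⟩

/-- **`YM3TorusSU2` WITH NON-TRIVIAL LIMIT POINTS, from the three cruxes**: the leaf statement's shape with the extra conjunct
`LimitPointsNontrivial (F.scheme ℰp γ)` for every family and every `γ ∈ (0, 1]` (threshold `γ₁ = 1`, as in `closes`). [cite: JaffeWittenClay2006, §4 p.6 and §6.5 p.11] -/
theorem ym3TorusSU2_nontrivial_of_cruxes (h200 : MinimiserStabilityRegPr) (h201 : FluctuationComparisonRegPrIntL) (hK2 : HistoryTailL) :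
    ∃ γ₁ : ℝ, 0 < γ₁ ∧ ∀ (F : T3Family) (γ : ℝ), 0 < γ → γ ≤ γ₁ →
      ContinuumYM3Torus F ℰp γ ∧ LimitPointsNontrivial (F.scheme ℰp γ) := by
  refine ⟨1, one_pos, fun F γ hγ _ => ?_⟩
  obtain ⟨hY, c, hc⟩ := ym3_nontrivial_of_cruxes h200 h201 hK2 F hγ (0 : F.USite) (show (0 : Fin 3) ≠ 1 by decide)
  exact ⟨hY, limitPointsNontrivial_of_uniformVariance hc⟩

/-- **THE NON-GAUSSIAN LIMIT LOOP LAW from the three cruxes**: for every family and every `γ > 0` the loop laws converge weakly along the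
full sequence to a law on `[-1,1]^{ULoop3 F}` carrying all limits of joint expectations, whose plaquette marginal has variance `≥ c > 0` and is
NOT Gaussian. [cite: JaffeWittenClay2006, §4 p.6] -/
theorem limitLoopLaw_nondegenerate_of_cruxes (h200 : MinimiserStabilityRegPr) (h201 : FluctuationComparisonRegPrIntL) (hK2 : HistoryTailL)
    (F : T3Family) {γ : ℝ} (hγ : 0 < γ) (x : F.USite) {μ ν : Fin 3} (hμν : μ ≠ ν) :
    ∃ (c : ℝ) (νL : ProbabilityMeasure (T4LimitLaw.Cube (ULoop3 F))), 0 < c ∧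
      Tendsto (loopLaw F (F.avgMeasurable_of_measurableE ℰp measurableE_ℰp) hγ.le) atTop (𝓝 νL) ∧
      (∀ Cs : List (ULoop3 F), Tendsto (fun K => (F.scheme ℰp γ).expectAt K Cs) atTop
        (𝓝 (∫ y, T4LimitLaw.monomial Cs y ∂(νL : Measure (T4LimitLaw.Cube (ULoop3 F)))))) ∧
      c ≤ ProbabilityTheory.variance (fun y => ((y (plaquette3 x μ ν) : Set.Icc (-1 : ℝ) 1) : ℝ))
        (νL : Measure (T4LimitLaw.Cube (ULoop3 F))) ∧
      ∀ (a : ℝ) (v : NNReal), (νL : Measure (T4LimitLaw.Cube (ULoop3 F))).map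
        (fun y => ((y (plaquette3 x μ ν) : Set.Icc (-1 : ℝ) 1) : ℝ)) ≠ ProbabilityTheory.gaussianReal a v := by
  obtain ⟨hY, c, hc⟩ := ym3_nontrivial_of_cruxes h200 h201 hK2 F hγ x hμν
  obtain ⟨νL, h1, h2, h3, h4⟩ := limitLoopLaw_nondegenerate F measurableE_ℰp hγ.le hY.1 hc
  exact ⟨c, νL, hc.1, h1, h2, h3, h4⟩

end Summit.QuantumFields.YangMills.Theorems.UnitScaleTiltNontrivial

end
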